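import Summits.BirchSwinnertonDyer.Rank1Residual.P2.PrintCf2GenusPeriodTransferLayer
import HarnessLib

/-!
# Crux `PrintCf2.RamifiedOffTYZOfFacts` (item stmt-BirchSwinnertonDyer-20509; items 23431/23432 of route `PrintCf2` rev ≥ 33),
# line `offtyz-v7`: THEOREM B AT LAYER 1, part 2 — the DICHOTOMY «`g^{g(d)} ∈ Γ` and `g·Z(d) = Z(d)`, or `g^{g(d)} ∈ σΓ` and
# `g·Z(d) = Z(d) + τ(1)`» for every `g` trivial on `L_d(i)`, on every block `d ≡ 5 (mod 8)` of the printed CM-point layer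
# `CMPointGaloisPrinted` (kernel bookkeeping; sequel of `PrintCf2GenusPeriodTransferLayer.lean`)

Cell `bsd-print-cf2`, seat `bsd-print-cf2-ty2` (typer; the DISCHARGE INTERFACE «displayed predicate ⟹ the door's hypothesis»), for the
LEAD's note `Cruxes/RamifiedOffTYZOfFacts/Lines/offtyz_v7_TransferLayer.md` (cruxlead-20509 g4) §3 (THEOREM B, (B1)/(B2)), §8, §10 (b).
HONEST FRAMING: theorems only (no `def`, no named fact, no `sorry`); nothing here closes an item; BSD is not proved by any of this; no class is
closed.  beyond-print theorem: NO (Galois bookkeeping of printed sentences).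

WHAT.  §5 `galPt_sum_dichotomy` (abstract: `Γ ≤ Q ≤ Gal(ℍ′_n/ℚ)`, `Γ` normal fixing `z`, `Q/Γ` abelian, `Φ ⊆ Q` representing `Q/⟨σ⟩Γ`
exactly once, `σ ∈ Q`, `σ² ∈ Γ`, `σ·z = z + τ(1)` ⟹ for `g ∈ Q`: `g^{#Φ} ∈ Γ ∧ g·Z = Z` or `g^{#Φ}σ⁻¹ ∈ Γ ∧ g·Z = Z + τ(1)`,
`Z = Σ_{t∈Φ} t·z`), `galPt_sum_ne_iff` (mover ⟺ `g^{#Φ} ≡ σ`).  §6 the instantiation at a block `d ≡ 5 (mod 8)` of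
`GenusPointData.CMBlockSpec` with `Q = Gal(ℍ′_n/L_d(i))` (the automorphisms `TrivialOnL d`), `Γ = Gal(ℍ′_n/H′_d)`:
**`galPt_genusPeriod_dichotomy_of_cmBlockSpec`**, **`galPt_genusPeriod_ne_iff_of_cmBlockSpec`** (`g·Z(d) ≠ Z(d) ⟺ g^{g(d)}σ⁻¹ ∈ Gal(ℍ′_n/H′_d)`,
then `g·Z(d) = Z(d) + τ(1)`), `sigma_trivialOnL_and_not_mem_of_cmBlockSpec`; `trivialOnL_of_fixesGenusField` (`d ≡ 1 (mod 4)`: trivial on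
`L_d` ⟹ trivial on `L_d(i)`).  NEXT (sequel, once `CMPointRingClassDisplays` lands): with the ring class dictionary `ρ_d : Gal(ℍ′_n/K_d) ↠ Pic(𝒪₂)`,
«`∃ x ∈ Pic(𝒪₂)²` with `x^{g(d)} = ρ_d(σ)`» ⟹ a mover of `Z(d)` — the input of the GALOIS-MOVER DOOR (p672160) per family.

References: [cite: TianYuanZhang2017, §3.1 (p0011 L1–L13, L53–L66), Prop. 3.2 (1) (p0010 L108–L109), Thm. 3.6 (1) (p0012 L27–L29), proof of Lemma 3.21 (p0020 L27–L63), §2.1 (J725 L11–L16)];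
the LEAD note (crux dir) §3 (Theorem B), §8, §10 (b).
-/

noncomputable section

open scoped Classical

open WeierstrassCurve WeierstrassCurve.Affine Literature.NumberTheory.EllipticCurves
  Literature.NumberTheory.EllipticCurves.TianYuanZhang2017
  Literature.NumberTheory.EllipticCurves.TianYuanZhang2017.W2

set_option autoImplicit false

namespace Summit.BirchSwinnertonDyer.Rank1Residual.P2.GenusPeriodTransferLayer

open Summit.BirchSwinnertonDyer.Rank1Residual.P2.ThetaDescent

variable {n : ℕ}

/-! ## §5 THEOREM B at layer 1: the dichotomy, abstract form -/

section Dichotomy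

variable (D : GenusPointData n) (Q Γ : Subgroup (D.H ≃ₐ[ℚ] D.H)) (z : APoint D.H) (Φ : Finset (D.H ≃ₐ[ℚ] D.H))
  (σ : D.H ≃ₐ[ℚ] D.H)

/-- **THEOREM B, layer 1 (abstract).**  `Γ ≤ Q ≤ Gal(ℍ′_n/ℚ)`, `Γ` normal and fixing `z`, `Q/Γ` abelian, `Φ ⊆ Q` representing `Q/⟨σ⟩Γ`
exactly once (`hrep`, `huniq`), `σ ∈ Q`, `σ² ∈ Γ`, `σ·z = z + τ(1)`.  Then for every `g ∈ Q`, with `Z := Σ_{t∈Φ} t·z`: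
EITHER `g^{#Φ} ∈ Γ` and `g·Z = Z`, OR `g^{#Φ} σ⁻¹ ∈ Γ` and `g·Z = Z + τ(1)`.
[cite: TianYuanZhang2017, proof of Lemma 3.21 (p0020 L55–L62) and Thm. 3.6 (1) (p0012 L27–L29)] -/
theorem galPt_sum_dichotomy (hΓQ : Γ ≤ Q) (hΓn : ∀ g γ, γ ∈ Γ → g * γ * g⁻¹ ∈ Γ)
    (hΓz : ∀ γ ∈ Γ, D.galPt γ z = z) (hcomm : ∀ s ∈ Q, ∀ t ∈ Q, s⁻¹ * t⁻¹ * s * t ∈ Γ)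
    (hΦ : ∀ t ∈ Φ, t ∈ Q) (hσ : σ ∈ Q) (hσσ : σ * σ ∈ Γ) (hσz : D.galPt σ z = z + tauOne)
    (hrep : ∀ x ∈ Q, ∃ r ∈ Φ, x * r⁻¹ ∈ Γ ∨ x * (r * σ)⁻¹ ∈ Γ)
    (huniq : ∀ t₁ ∈ Φ, ∀ t₂ ∈ Φ, (t₁ * t₂⁻¹ ∈ Γ ∨ t₁ * (t₂ * σ)⁻¹ ∈ Γ) → t₁ = t₂)
    {g : D.H ≃ₐ[ℚ] D.H} (hg : g ∈ Q) :
    (g ^ Φ.card ∈ Γ ∧ D.galPt g (∑ t ∈ Φ, D.galPt t z) = ∑ t ∈ Φ, D.galPt t z) ∨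
    (g ^ Φ.card * σ⁻¹ ∈ Γ ∧ D.galPt g (∑ t ∈ Φ, D.galPt t z) = (∑ t ∈ Φ, D.galPt t z) + tauOne) := by
  have hΓn' : ∀ g ∈ Q, ∀ γ ∈ Γ, g * γ * g⁻¹ ∈ Γ := fun g _ γ hγ => hΓn g γ hγ
  obtain ⟨π, ε, hπΦ, hε, hclass⟩ := exists_perm_data Q Γ Φ σ hΦ hg hrep
  have hπinj : Set.InjOn π Φ := injOn_of_perm_data Q Γ Φ σ hΓQ hΓn' hΦ hσ hσσ hg huniq π ε hε hclass
  have hgrp := pow_card_mul_inv_pow_sum_mem Q Γ hΓn' hcomm Φ hΦ hσ hg π ε hπΦ hπinj hclass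
  have hpts := galPt_sum_eq_add_sum_nsmul D Γ z hΓn hΓz hσz Φ g π ε hπΦ hπinj hclass
  set m : ℕ := ∑ t ∈ Φ, ε t with hm
  -- reduce `σ^m` modulo `σ² ∈ Γ` and `m·τ(1)` modulo `2τ(1) = 0`
  have hσpow : ∀ k : ℕ, σ ^ (2 * k) ∈ Γ := fun k => by
    rw [pow_mul, sq]; exact Γ.pow_mem hσσ k
  rw [nsmul_tauOne_eq_mod_two] at hpts
  rcases Nat.even_or_odd m with ⟨k, hk⟩ | ⟨k, hk⟩
  · left
    have h2 : m % 2 = 0 := by omega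
    rw [h2, zero_smul, add_zero] at hpts
    refine ⟨?_, hpts⟩
    have : σ ^ m ∈ Γ := by rw [hk, ← two_mul]; exact hσpow k
    have := Γ.mul_mem hgrp this
    rwa [inv_mul_cancel_right] at this
  · right
    have h2 : m % 2 = 1 := by omega
    rw [h2, one_smul] at hpts
    refine ⟨?_, hpts⟩
    -- `g^{#Φ} (σ^m)⁻¹ ∈ Γ`, `σ^m = σ^{2k} σ`
    have e : g ^ Φ.card * σ⁻¹ = g ^ Φ.card * (σ ^ m)⁻¹ * σ ^ (2 * k) := by
      rw [hk]; group
    rw [e]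
    exact Γ.mul_mem hgrp (hσpow k)

/-- **`σ ∉ Γ`** (it moves `z`, which `Γ` fixes; `τ(1) ≠ 0`). [cite: TianYuanZhang2017, Thm. 3.6 (1) (p0012 L27–L29)] -/
theorem sigma_not_mem (hΓz : ∀ γ ∈ Γ, D.galPt γ z = z) (hσz : D.galPt σ z = z + tauOne) : σ ∉ Γ := by
  intro hσ
  have := hΓz σ hσ
  rw [hσz, add_eq_left] at this
  exact tauOne_ne_zero this

/-- **The mover criterion (abstract)**: under the hypotheses of `galPt_sum_dichotomy`, `g ∈ Q` MOVES `Z = Σ_{t∈Φ} t·z` iff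
`g^{#Φ} ≡ σ (mod Γ)`, and then `g·Z = Z + τ(1)`. [cite: TianYuanZhang2017, proof of Lemma 3.21 (p0020 L55–L62)] -/
theorem galPt_sum_ne_iff (hΓQ : Γ ≤ Q) (hΓn : ∀ g γ, γ ∈ Γ → g * γ * g⁻¹ ∈ Γ)
    (hΓz : ∀ γ ∈ Γ, D.galPt γ z = z) (hcomm : ∀ s ∈ Q, ∀ t ∈ Q, s⁻¹ * t⁻¹ * s * t ∈ Γ)
    (hΦ : ∀ t ∈ Φ, t ∈ Q) (hσ : σ ∈ Q) (hσσ : σ * σ ∈ Γ) (hσz : D.galPt σ z = z + tauOne)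
    (hrep : ∀ x ∈ Q, ∃ r ∈ Φ, x * r⁻¹ ∈ Γ ∨ x * (r * σ)⁻¹ ∈ Γ)
    (huniq : ∀ t₁ ∈ Φ, ∀ t₂ ∈ Φ, (t₁ * t₂⁻¹ ∈ Γ ∨ t₁ * (t₂ * σ)⁻¹ ∈ Γ) → t₁ = t₂)
    {g : D.H ≃ₐ[ℚ] D.H} (hg : g ∈ Q) :
    D.galPt g (∑ t ∈ Φ, D.galPt t z) ≠ ∑ t ∈ Φ, D.galPt t z ↔ g ^ Φ.card * σ⁻¹ ∈ Γ := by
  have hσΓ : σ ∉ Γ := sigma_not_mem D Γ z σ hΓz hσz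
  rcases galPt_sum_dichotomy D Q Γ z Φ σ hΓQ hΓn hΓz hcomm hΦ hσ hσσ hσz hrep huniq hg with ⟨h1, h2⟩ | ⟨h1, h2⟩
  · constructor
    · intro h; exact absurd h2 h
    · intro h
      exfalso
      apply hσΓ
      have := Γ.mul_mem (Γ.inv_mem h) h1
      rwa [mul_inv_rev, inv_inv, mul_assoc, inv_mul_cancel, mul_one] at this
  · constructor
    · intro _; exact h1
    · intro _
      rw [h2, Ne, add_eq_left]
      exact tauOne_ne_zero

end Dichotomy

/-! ## §6 Instantiation at a block `d ≡ 5 (mod 8)` of `CMPointGaloisPrinted` -/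

section Block

variable (D : GenusPointData n)

/-- For an odd block `d ≡ 1 (mod 4)` (e.g. `d ≡ 5 (mod 8)`), an automorphism trivial on the genus field `L_d` is trivial on `L_d(i)`:
it fixes `√(d*) = i·√−d` and `√−d`, hence `i`, hence every `√−d′ = √(d′*)` or `√(d′*)/i` (`d′ ∣ d`, all odd).
[cite: TianYuanZhang2017, §2.1 (J725 L11–L16: d* = (−1)^{(d−1)/2} d) and proof of Lemma 3.21 (p0020 L55–L56: L_n(i) = L_n for n ≡ 5 (mod 8))] -/
theorem trivialOnL_of_fixesGenusField {d : ℕ} (hd : d ∈ n.divisors) (hd4 : d % 4 = 1) (hd1 : 1 < d)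
    {g : D.H ≃ₐ[ℚ] D.H} (hg : D.FixesGenusField d g) : D.TrivialOnL d g := by
  have hodd : Odd d := Nat.odd_iff.mpr (by omega)
  have hsq : D.sqrtNeg d ^ 2 = -((d : ℕ) : D.H) := D.sqrtNeg_sq d hd
  have hs0 : D.sqrtNeg d ≠ 0 := by
    intro h0
    rw [h0, zero_pow two_ne_zero, eq_comm, neg_eq_zero, Nat.cast_eq_zero] at hsq
    omega
  have him0 : D.im ≠ 0 := fun h0 => by have := D.im_sq; rw [h0] at this; norm_num at this
  -- `g(i) = i` from `g(i·√−d) = i·√−d` and `g(√−d) = √−d`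
  have hroot : D.genusRoot d = D.im * D.sqrtNeg d := by
    unfold GenusPointData.genusRoot; rw [if_pos hd4]
  have hgi : g D.im = D.im := by
    have h := hg.2 d (Nat.mem_divisors_self d (by omega)) hodd hd1
    rw [hroot, map_mul, hg.1] at h
    exact mul_right_cancel₀ hs0 h
  refine ⟨hgi, fun d' hd' hd1' => ?_⟩
  have hodd' : Odd d' := hodd.of_dvd_nat (Nat.dvd_of_mem_divisors hd')
  have h := hg.2 d' hd' hodd' hd1'
  unfold GenusPointData.genusRoot at h
  by_cases h4 : d' % 4 = 1
  · rw [if_pos h4, map_mul, hgi] at h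
    exact mul_left_cancel₀ him0 h
  · rwa [if_neg h4] at h

/-- The automorphisms trivial on `L_d(i)` are closed under composition. [cite: TianYuanZhang2017, proof of Lemma 3.21 (p0020 L55–L58)] -/
theorem trivialOnL_mul {d : ℕ} {a b : D.H ≃ₐ[ℚ] D.H} (ha : D.TrivialOnL d a) (hb : D.TrivialOnL d b) :
    D.TrivialOnL d (a * b) :=
  ⟨by rw [AlgEquiv.mul_apply, hb.1, ha.1], fun d' hd' h1 => by rw [AlgEquiv.mul_apply, hb.2 d' hd' h1, ha.2 d' hd' h1]⟩

/-- The identity is trivial on `L_d(i)`. [cite: TianYuanZhang2017, proof of Lemma 3.21 (p0020 L55–L58)] -/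
theorem trivialOnL_one (d : ℕ) : D.TrivialOnL d 1 :=
  ⟨rfl, fun _ _ _ => rfl⟩

/-- The automorphisms trivial on `L_d(i)` are closed under inverses. [cite: TianYuanZhang2017, proof of Lemma 3.21 (p0020 L55–L58)] -/
theorem trivialOnL_inv {d : ℕ} {a : D.H ≃ₐ[ℚ] D.H} (ha : D.TrivialOnL d a) : D.TrivialOnL d a⁻¹ := by
  refine ⟨?_, fun d' hd' h1 => ?_⟩
  · have h := congrArg (⇑a⁻¹) ha.1
    rw [show a⁻¹ (a D.im) = D.im from a.symm_apply_apply D.im] at h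
    exact h.symm
  · have h := congrArg (⇑a⁻¹) (ha.2 d' hd' h1)
    rw [show a⁻¹ (a (D.sqrtNeg d')) = D.sqrtNeg d' from a.symm_apply_apply _] at h
    exact h.symm

/-- **THEOREM B AT LAYER 1 on a block `d ≡ 5 (mod 8)` of the CM-point display.**  For `D : GenusPointData n` and objects
`(z, Φ, ΓH, ΓH', σ, c)` with `D.CMBlockSpec d z Φ ΓH ΓH' σ c`, EVERY automorphism `g` of `ℍ′_n` trivial on `L_d(i)` satisfies:
either `g^{g(d)} ∈ Gal(ℍ′_n/H′_d)` and `g·Z(d) = Z(d)`, or `g^{g(d)} ∈ σ·Gal(ℍ′_n/H′_d)` and `g·Z(d) = Z(d) + τ(1)`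
(`g(d) = gK d = #Φ₀`).  The note's (B1)/(B2) in kernel form.
[cite: TianYuanZhang2017, §3.1 (p0011 L53–L58), Prop. 3.2 (1) (p0010 L108–L109), Thm. 3.6 (1) (p0012 L27–L29), proof of Lemma 3.21 (p0020 L55–L62)] -/
theorem galPt_genusPeriod_dichotomy_of_cmBlockSpec {d : ℕ} (hd : d ∈ n.divisors) (hd8 : d % 8 = 5)
    {z : APoint D.H} {Φ : Finset (D.H ≃ₐ[ℚ] D.H)} {ΓH ΓH' : Subgroup (D.H ≃ₐ[ℚ] D.H)} {σ c : D.H ≃ₐ[ℚ] D.H}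
    (h : D.CMBlockSpec d z Φ ΓH ΓH' σ c) {g : D.H ≃ₐ[ℚ] D.H} (hg : D.TrivialOnL d g) :
    (g ^ gK d ∈ ΓH' ∧ D.galPt g (D.Z d) = D.Z d) ∨
    (g ^ gK d * σ⁻¹ ∈ ΓH' ∧ D.galPt g (D.Z d) = D.Z d + tauOne) := by
  obtain ⟨⟨hZ, hcard⟩, hΦL, ⟨hΓz, hΓn, hcomm⟩, ⟨hΓ'Γ, hΓfix⟩, -, ⟨hσΓ, hσσ, hσz⟩, hrep, huniq⟩ := h
  have hd4 : d % 4 = 1 := by omega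
  have hd1 : 1 < d := by omega
  -- the subgroup `Q = Gal(ℍ′_n/L_d(i))`
  let Q : Subgroup (D.H ≃ₐ[ℚ] D.H) :=
    { carrier := {x | D.TrivialOnL d x}
      mul_mem' := fun {a b} ha hb => trivialOnL_mul D ha hb
      one_mem' := trivialOnL_one D d
      inv_mem' := fun {a} ha => trivialOnL_inv D ha }
  have hQ : ∀ x, x ∈ Q ↔ D.TrivialOnL d x := fun _ => Iff.rfl
  have hK : ∀ x, D.TrivialOnL d x → x (D.sqrtNeg d) = D.sqrtNeg d := fun x hx =>
    hx.2 d (Nat.mem_divisors_self d (by omega)) hd1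
  have hΓQ : ΓH' ≤ Q := fun γ hγ =>
    (hQ γ).mpr (trivialOnL_of_fixesGenusField D hd hd4 hd1 (hΓfix γ (hΓ'Γ γ hγ)))
  have hσQ : σ ∈ Q := (hQ σ).mpr (trivialOnL_of_fixesGenusField D hd hd4 hd1 (hΓfix σ hσΓ))
  have hΦQ : ∀ t ∈ Φ, t ∈ Q := fun t ht => (hQ t).mpr (hΦL t ht)
  have hcommQ : ∀ s ∈ Q, ∀ t ∈ Q, s⁻¹ * t⁻¹ * s * t ∈ ΓH' := fun s hs t ht =>
    hcomm s t (hK s ((hQ s).mp hs)) (hK t ((hQ t).mp ht))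
  have hrepQ : ∀ x ∈ Q, ∃ r ∈ Φ, x * r⁻¹ ∈ ΓH' ∨ x * (r * σ)⁻¹ ∈ ΓH' := fun x hx => hrep x ((hQ x).mp hx)
  have hgQ : g ∈ Q := (hQ g).mpr hg
  have key := galPt_sum_dichotomy D Q ΓH' z Φ σ hΓQ (fun g γ hγ => hΓn g γ hγ) hΓz hcommQ hΦQ hσQ hσσ hσz
    hrepQ huniq hgQ
  rw [hZ, ← hcard]
  exact key

/-- **The mover criterion on a block `d ≡ 5 (mod 8)`**: for `g` trivial on `L_d(i)`, `g·Z(d) ≠ Z(d)` iff `g^{g(d)} σ⁻¹ ∈ Gal(ℍ′_n/H′_d)`;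
in that case `g·Z(d) = Z(d) + τ(1)`. [cite: TianYuanZhang2017, proof of Lemma 3.21 (p0020 L55–L62) and Thm. 3.6 (1) (p0012 L27–L29)] -/
theorem galPt_genusPeriod_ne_iff_of_cmBlockSpec {d : ℕ} (hd : d ∈ n.divisors) (hd8 : d % 8 = 5)
    {z : APoint D.H} {Φ : Finset (D.H ≃ₐ[ℚ] D.H)} {ΓH ΓH' : Subgroup (D.H ≃ₐ[ℚ] D.H)} {σ c : D.H ≃ₐ[ℚ] D.H}
    (h : D.CMBlockSpec d z Φ ΓH ΓH' σ c) {g : D.H ≃ₐ[ℚ] D.H} (hg : D.TrivialOnL d g) :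
    (D.galPt g (D.Z d) ≠ D.Z d ↔ g ^ gK d * σ⁻¹ ∈ ΓH') ∧
    (g ^ gK d * σ⁻¹ ∈ ΓH' → D.galPt g (D.Z d) = D.Z d + tauOne) := by
  have hσΓ' : σ ∉ ΓH' := sigma_not_mem D ΓH' z σ h.2.2.1.1 h.2.2.2.2.2.1.2.2
  rcases galPt_genusPeriod_dichotomy_of_cmBlockSpec D hd hd8 h hg with ⟨h1, h2⟩ | ⟨h1, h2⟩
  · refine ⟨⟨fun hne => absurd h2 hne, fun hm => ?_⟩, fun hm => ?_⟩ <;>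
    · exfalso
      apply hσΓ'
      have := ΓH'.mul_mem (ΓH'.inv_mem hm) h1
      rwa [mul_inv_rev, inv_inv, mul_assoc, inv_mul_cancel, mul_one] at this
  · refine ⟨⟨fun _ => h1, fun _ => ?_⟩, fun _ => h2⟩
    rw [h2, Ne, add_eq_left]
    exact tauOne_ne_zero

/-- **`σ` itself is trivial on `L_d(i)` and does not lie in `Gal(ℍ′_n/H′_d)`** (block `d ≡ 5 (mod 8)`): the class `σ·Gal(ℍ′_n/H′_d)` is a
genuine element of order `2` of `Gal(H′_d/L_d(i))`. [cite: TianYuanZhang2017, §3.1 (p0011 L3–L4) and Thm. 3.6 (1) (p0012 L27–L29)] -/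
theorem sigma_trivialOnL_and_not_mem_of_cmBlockSpec {d : ℕ} (hd : d ∈ n.divisors) (hd8 : d % 8 = 5)
    {z : APoint D.H} {Φ : Finset (D.H ≃ₐ[ℚ] D.H)} {ΓH ΓH' : Subgroup (D.H ≃ₐ[ℚ] D.H)} {σ c : D.H ≃ₐ[ℚ] D.H}
    (h : D.CMBlockSpec d z Φ ΓH ΓH' σ c) : D.TrivialOnL d σ ∧ σ ∉ ΓH' ∧ σ * σ ∈ ΓH' :=
  ⟨trivialOnL_of_fixesGenusField D hd (by omega) (by omega) (h.2.2.2.1.2 σ h.2.2.2.2.2.1.1),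
    sigma_not_mem D ΓH' z σ h.2.2.1.1 h.2.2.2.2.2.1.2.2, h.2.2.2.2.2.1.2.1⟩

end Block

end Summit.BirchSwinnertonDyer.Rank1Residual.P2.GenusPeriodTransferLayer

end
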